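/-
Copyright (c) 2026 the pub-hodgecm-mathlib formalisation cell (harness21).  Prover seat hodgecm-mathlib-LH4-p14 (g8) (L1 valve hand; K1b∕ρ desk K2Liu-p14 (g4)
DESK WORD #6 (P-dec) hands, letter (ii)), Track B «K2-LIT» ∕ hLiu418 #184♮, socket #41 KIND 1, package (K1b-♮), letter (P-dec) = (dec-1) ∘ (dec-3) ∘ (dec-2):
(dec-1) THE EULER TRANSFER — «a bound on the `T`-part `A₁` is a bound on the Whittaker coefficient».  THEOREMS ONLY.
-/
import Summits.HodgeConjecture.HodgeConjecture.Theorems.K2LiuGoodPlaceWhittakerProductBound   -- ★ `norm_inv_partialL_le_uniform` (U-uniform inverse partial `L`)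
import Summits.HodgeConjecture.HodgeConjecture.Theorems.K2LiuKindOneLineWhittakerPackageFine   -- ★ p862999 (KW1-f′): the currency `(X, ht, Φ, A₁, U₁)`, `hEuler₁`, `hfine`
import HarnessLib

/-!
# Crux `HLiu418`, socket #41, KIND 1 — (P-dec) letter (dec-1) `K2LiuKindOneLineEulerTransfer`: A BOUND ON THE `T`-PART IS A BOUND ON THE LINE WHITTAKER COEFFICIENT

Cell `hodgecm-mathlib`, crux item hLiu418 = `stmt-HodgeConjecture-24832` (helper lane `--supports … --as helper`, count-neutral), route of record `HCCMUnconditional`;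
squad K2 ∕ K2Liu, road `K2_Liu`, socket #41, KIND 1, package (K1b-♮) (desk K2Liu-p14 (g4): ★ p863141 package, ENGINE `exists_kindOne_lineTerm_of_pinnedTerm`,
★ p863230∕p863263 pin; DESK WORD #6 (d) = the `D`-polynomial decay letter `hTdec`).  This hand's census (2026-09-05T00:02Z) factors (P-dec) as
(dec-1) EULER TRANSFER ∘ (dec-3) FINE → TOP CURRENCY ∘ (dec-2) THE FINE LETTER; THIS FILE is (dec-1), fully discharged.
THE MATHEMATICS [KudlaRallis1994, §1], [Tan1999, §2–§3], [NeukirchANT1999, Ch. VII §8]: at `n = 1` the Whittaker coefficient of a pulled-back line family factors as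
`W⁽¹⁾_μ(Φ_x(s))(1) = A₁(μ, s, x) · (L^{U₁(μ,x)}(2(s + ½) + 1, ε_{L∕L⁺}))⁻¹` (★ (KW1-b) ∕ (KW1-f′) `hEuler₁`, `det μ ≠ 0`), and the inverse partial `L`-value is bounded
UNIFORMLY in the omitted set `U` and in `re s ≥ σ₀ > 0` (`re(2s + 2) ≥ 2σ₀ + 2 > 1`: ★ `norm_inv_partialL_le_uniform`, `|ε(ϖ_v)| = 1` by ★ `isFiniteOrder_quadraticHeckeCharCM`).
Hence EVERY majorant of `A₁` — the fine form (dec-2), the height∕`D`-polynomial form (d) — is a majorant of `W⁽¹⁾` with the constant multiplied by `C_L(σ₀)`; near a point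
`z` of the window one takes the radius `≤ re z ∕ 2`, so `σ₀ = re z ∕ 2` serves.
* §1 **`norm_inv_lineL_le_uniform_cm`** — `∃ C > 0, ∀ U s, σ₀ ≤ re s → ‖(L^U(2(s+½)+1, ε_{L∕L⁺}))⁻¹‖ ≤ C` (`0 < σ₀`).
* §2 **`norm_le_of_eq_mul_of_le`** — the pointwise algebra `W = A·ℓ`, `‖A‖ ≤ C₁·G`, `‖ℓ‖ ≤ C₂ ⇒ ‖W‖ ≤ (C₂·C₁)·G`.
* §3 **`exists_norm_whittakerDelta_le_of_linePart_le`** — in (KW1-f′)'s currency `(ν₁, X, Φ, A₁, U₁, hEuler₁)`: for every `σ₀ > 0` ONE `C_L > 0` such that every pointwise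
  bound `‖A₁ μ s x‖ ≤ C₁·G` at `det μ ≠ 0`, `σ₀ ≤ re s` gives `‖W⁽¹⁾_μ(Φ x s)(1)‖ ≤ (C_L·C₁)·G` — shape-agnostic (fine, height, `D`-polynomial: the consumer's `G`).
* §4 the two shapes of record, READ through §3: **`exists_whittakerDelta_fine_of_fine`** ((KW1-f′)'s `hfine` bytes for `A₁` ⇒ the same for `W⁽¹⁾` on `det μ ≠ 0`, radius
  `min r (re z ∕ 2)`), and **`exists_whittakerDelta_dec_of_dec`** (the TOP-shape `hdec₁` bytes for `A₁` ⇒ the same for `W⁽¹⁾` on `det μ ≠ 0`).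
HONEST LABEL.  Count-neutral helper, hypothesis-first in `hEuler₁` and the `A₁`-majorant (their payers: ★ (KW1-b) p862675 ∕ the organ's per-place road); closes no socket:
`HC_CM` is proved only modulo the 7 printed citations (2 remaining named inputs: hLiu418 = `stmt-HodgeConjecture-24832`, h413 = `stmt-HodgeConjecture-24833`) until rung 0 closes.

## References
* [KudlaRallis1994] S. Kudla, S. Rallis, Ann. of Math. 140 (1994): §1 (Euler factorisation of non-singular Whittaker coefficients; the normalising `L`-factor).
* [Tan1999] V. Tan, Canad. J. Math. 51 (1999): §2–§3 (rank one: `b₁(s) = L(2s+1, ε)`).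
* [NeukirchANT1999] J. Neukirch, *Algebraic Number Theory* (1999): Ch. VII §8 (absolute convergence and uniform bounds of Euler products on `Re > 1`).
-/

set_option autoImplicit false
-- the mandated namespace repeats the single-problem summit's segment (`HodgeConjecture.HodgeConjecture`)
set_option linter.dupNamespace false

noncomputable section

open scoped Matrix NNReal
-- `Classical` is needed to see the Mathlib normed-ring instances on `mixedSpace L` (as in ★ (KW1-f′))
open scoped Classical
open NumberField IsDedekindDomain MeasureTheory

namespace Summit.HodgeConjecture.HodgeConjecture.Cruxes.HLiu418.K2LiuKindOneLineEulerTransfer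

open Literature.NumberTheory.Automorphic Literature.NumberTheory.GaloisRepresentations Literature.NumberTheory.LFunctions
open Literature.NumberTheory.GelbartRogawski1991 Literature.NumberTheory.GelbartRogawski1991.GRConstruction
open Literature.NumberTheory.K2Lit.SiegelDoubled
open Summit.HodgeConjecture.HodgeConjecture.Cruxes.HLiu418.K2LiuSiegelUnipotentFourierDefs
open Summit.HodgeConjecture.HodgeConjecture.Cruxes.HLiu418.K2LiuGoodPlaceWhittakerProductBound (norm_inv_partialL_le_uniform)

/-! ## §1 The inverse partial `L`-value of the line is bounded uniformly in `U` and in `re s ≥ σ₀ > 0` -/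

/-- **`‖(L^U(2(s+½)+1, ε_{L∕L⁺}))⁻¹‖ ≤ C(σ₀)` UNIFORMLY IN THE OMITTED SET `U` AND IN `re s ≥ σ₀ > 0`.**  `ε_{L∕L⁺} = quadraticHeckeCharCM L` has finite order (★
`isFiniteOrder_quadraticHeckeCharCM`), so `|ε(ϖ_v)| = 1`; `re(2(s+½)+1) = 2 re s + 2 ≥ 2σ₀ + 2 > 1`, and ★ `norm_inv_partialL_le_uniform` applies at `x₁ := 2σ₀ + 2`.
[cite: NeukirchANT1999, Ch. VII §8] [cite: KudlaRallis1994, §1] -/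
theorem norm_inv_lineL_le_uniform_cm (L : Type) [Field L] [NumberField L] [IsCMField L] {σ₀ : ℝ} (hσ₀ : 0 < σ₀) :
    ∃ C : ℝ, 0 < C ∧ ∀ (U : Set (HeightOneSpectrum (𝓞 ↥(maximalRealSubfield L)))) (s : ℂ), σ₀ ≤ s.re →
      ‖(partialStandardL U (fun v => {(quadraticHeckeCharCM L).valueAtUniformizer v}) (2 * (s + 1 / 2) + 1))⁻¹‖ ≤ C := by
  have hε : (quadraticHeckeCharCM L).IsUnitary :=
    (Literature.RepresentationTheory.HarrisKudlaSweet1996.isFiniteOrder_quadraticHeckeCharCM (L := L)).isUnitary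
  obtain ⟨C, hC, h⟩ := norm_inv_partialL_le_uniform (F := ↥(maximalRealSubfield L)) (x₁ := 2 * σ₀ + 2) (by linarith)
    (a := fun v => (quadraticHeckeCharCM L).valueAtUniformizer v)
    fun v => (HeckeCharacter.norm_valueAtUniformizer_of_isUnitary hε v).le
  refine ⟨C, hC, fun U s hs => h U _ ?_⟩
  have hre : (2 * (s + 1 / 2) + 1 : ℂ).re = 2 * s.re + 2 := by
    simp only [Complex.add_re, Complex.mul_re, Complex.re_ofNat, Complex.im_ofNat, Complex.one_re, Complex.div_ofNat_re, zero_mul, sub_zero]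
    ring
  rw [hre]
  linarith

/-! ## §2 The pointwise algebra -/

/-- `W = A·ℓ`, `‖A‖ ≤ C₁·G`, `‖ℓ‖ ≤ C₂` ⇒ `‖W‖ ≤ (C₂·C₁)·G` (`C₁·G ≥ 0` is forced by the first bound). [folklore] -/
theorem norm_le_of_eq_mul_of_le {W A ℓ : ℂ} (h : W = A * ℓ) {C₁ G C₂ : ℝ} (hA : ‖A‖ ≤ C₁ * G) (hℓ : ‖ℓ‖ ≤ C₂) :
    ‖W‖ ≤ C₂ * C₁ * G := by
  have h0 : 0 ≤ C₁ * G := (norm_nonneg _).trans hA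
  calc ‖W‖ = ‖A‖ * ‖ℓ‖ := by rw [h, norm_mul]
    _ ≤ (C₁ * G) * C₂ := mul_le_mul hA hℓ (norm_nonneg _) h0
    _ = C₂ * C₁ * G := by ring

/-! ## §3 The transfer in (KW1-f′)'s currency -/

section Transfer

variable (L : Type) [Field L] [NumberField L] [IsCMField L]
variable {N₁ M₁ : ℕ} (e₁ : Fin N₁ × Fin M₁ ≃ Fin 1)
  (d₁ : Fin N₁ → L) (hd₁ : ∀ i, IsCMField.complexConj L (d₁ i) = d₁ i) (w₁ : Fin M₁ → L) (hw₁ : ∀ i, IsCMField.complexConj L (w₁ i) = w₁ i)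

/-- **(dec-1) THE EULER TRANSFER.**  In the currency of ★ (KW1-f′) `exists_kindW_line_letters_of_letters_fine` — a measure `ν₁` on `N_Δ⁽¹⁾(𝔸)`, points `X`, a family
`Φ : X → ℂ → H₁(𝔸) → ℂ`, the `T`-part `A₁` and the omitted sets `U₁` with the Euler identity `hEuler₁` on `{0 < re s}` at `det μ ≠ 0` — for every `σ₀ > 0` there is ONE
`C_L > 0` such that EVERY pointwise bound `‖A₁ μ s x‖ ≤ C₁ · G` with `det μ ≠ 0` and `σ₀ ≤ re s` yields `‖W⁽¹⁾_μ(Φ x s)(1)‖ ≤ (C_L · C₁) · G`.  The majorant `G` is the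
consumer's (fine form, height form, `D`-polynomial form). [cite: KudlaRallis1994, §1] [cite: Tan1999, §2–§3] [cite: NeukirchANT1999, Ch. VII §8] -/
theorem exists_norm_whittakerDelta_le_of_linePart_le
    [MeasurableSpace (unipDelta L e₁ d₁ hd₁ w₁ hw₁)] (ν₁ : Measure (unipDelta L e₁ d₁ hd₁ w₁ hw₁))
    {X : Type*} (Φ : X → ℂ → HA L e₁ d₁ hd₁ w₁ hw₁ → ℂ)
    (A₁ : skewMatrices ((IsCMField.complexConj L : L ≃ₐ[Fp L] L) : L →+* L) ((gramR L e₁ d₁ hd₁ w₁ hw₁).map (algebraMap (Fp L) L)) → ℂ → X → ℂ)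
    (U₁ : skewMatrices ((IsCMField.complexConj L : L ≃ₐ[Fp L] L) : L →+* L) ((gramR L e₁ d₁ hd₁ w₁ hw₁).map (algebraMap (Fp L) L)) → X →
      Set (HeightOneSpectrum (𝓞 ↥(maximalRealSubfield L))))
    (hEuler₁ : ∀ μ : skewMatrices ((IsCMField.complexConj L : L ≃ₐ[Fp L] L) : L →+* L) ((gramR L e₁ d₁ hd₁ w₁ hw₁).map (algebraMap (Fp L) L)),
      (μ : Matrix (Fin 1) (Fin 1) L).det ≠ 0 → ∀ (s : ℂ) (x : X), 0 < s.re →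
        whittakerDelta L e₁ d₁ hd₁ w₁ hw₁ ν₁ (μ : Matrix (Fin 1) (Fin 1) L) (Φ x s) 1 =
          A₁ μ s x * (partialStandardL (U₁ μ x) (fun v => {(quadraticHeckeCharCM L).valueAtUniformizer v}) (2 * (s + 1 / 2) + 1))⁻¹)
    {σ₀ : ℝ} (hσ₀ : 0 < σ₀) :
    ∃ CL : ℝ, 0 < CL ∧
      ∀ (μ : skewMatrices ((IsCMField.complexConj L : L ≃ₐ[Fp L] L) : L →+* L) ((gramR L e₁ d₁ hd₁ w₁ hw₁).map (algebraMap (Fp L) L))),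
        (μ : Matrix (Fin 1) (Fin 1) L).det ≠ 0 → ∀ (s : ℂ) (x : X), σ₀ ≤ s.re → ∀ {C₁ G : ℝ}, ‖A₁ μ s x‖ ≤ C₁ * G →
          ‖whittakerDelta L e₁ d₁ hd₁ w₁ hw₁ ν₁ (μ : Matrix (Fin 1) (Fin 1) L) (Φ x s) 1‖ ≤ CL * C₁ * G := by
  obtain ⟨CL, hCL, hL⟩ := norm_inv_lineL_le_uniform_cm L hσ₀
  refine ⟨CL, hCL, fun μ hμ s x hs C₁ G hA => ?_⟩
  have hs0 : 0 < s.re := lt_of_lt_of_le hσ₀ hs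
  exact norm_le_of_eq_mul_of_le (hEuler₁ μ hμ s x hs0) hA (hL (U₁ μ x) s hs)

/-! ## §4 The two shapes of record, read through §3 -/

/-- near `z` with `0 < re z`, the ball of radius `min r (re z ∕ 2)` lies in `{re z ∕ 2 ≤ re s}`. [folklore] -/
theorem half_re_le_re_of_dist_lt {z s : ℂ} {r : ℝ} (hs : dist s z < min r (z.re / 2)) : z.re / 2 ≤ s.re := by
  have h1 : |s.re - z.re| < z.re / 2 := by
    have h := lt_of_lt_of_le hs (min_le_right _ _)
    rw [Complex.dist_eq] at h
    exact lt_of_le_of_lt (by simpa only [Complex.sub_re] using Complex.abs_re_le_norm (s - z)) h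
  have h2 := (abs_lt.1 h1).1
  linarith

/-- **THE FINE SHAPE TRANSFERRED**: (KW1-f′)'s `hfine` bytes for `A₁` (an intrinsic majorant `B`, locally uniform in `s`, uniform in `(μ, x)`) ⇒ the same bytes for the
Whittaker coefficient on `det μ ≠ 0` (radius shrunk to `min r (re z ∕ 2)`, constant `C_L(re z ∕ 2) · C`). [cite: KudlaRallis1994, §1] [cite: Tan1999, §2–§3] -/
theorem exists_whittakerDelta_fine_of_fine
    [MeasurableSpace (unipDelta L e₁ d₁ hd₁ w₁ hw₁)] (ν₁ : Measure (unipDelta L e₁ d₁ hd₁ w₁ hw₁))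
    {X : Type*} (Φ : X → ℂ → HA L e₁ d₁ hd₁ w₁ hw₁ → ℂ)
    (A₁ : skewMatrices ((IsCMField.complexConj L : L ≃ₐ[Fp L] L) : L →+* L) ((gramR L e₁ d₁ hd₁ w₁ hw₁).map (algebraMap (Fp L) L)) → ℂ → X → ℂ)
    (U₁ : skewMatrices ((IsCMField.complexConj L : L ≃ₐ[Fp L] L) : L →+* L) ((gramR L e₁ d₁ hd₁ w₁ hw₁).map (algebraMap (Fp L) L)) → X →
      Set (HeightOneSpectrum (𝓞 ↥(maximalRealSubfield L))))
    (hEuler₁ : ∀ μ : skewMatrices ((IsCMField.complexConj L : L ≃ₐ[Fp L] L) : L →+* L) ((gramR L e₁ d₁ hd₁ w₁ hw₁).map (algebraMap (Fp L) L)),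
      (μ : Matrix (Fin 1) (Fin 1) L).det ≠ 0 → ∀ (s : ℂ) (x : X), 0 < s.re →
        whittakerDelta L e₁ d₁ hd₁ w₁ hw₁ ν₁ (μ : Matrix (Fin 1) (Fin 1) L) (Φ x s) 1 =
          A₁ μ s x * (partialStandardL (U₁ μ x) (fun v => {(quadraticHeckeCharCM L).valueAtUniformizer v}) (2 * (s + 1 / 2) + 1))⁻¹)
    (B : skewMatrices ((IsCMField.complexConj L : L ≃ₐ[Fp L] L) : L →+* L) ((gramR L e₁ d₁ hd₁ w₁ hw₁).map (algebraMap (Fp L) L)) → ℂ → X → ℝ)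
    (hfine : ∀ z : ℂ, 0 < z.re → ∃ C r : ℝ, 0 ≤ C ∧ 0 < r ∧ ∀ μ (s : ℂ), dist s z < r → ∀ x : X, ‖A₁ μ s x‖ ≤ C * B μ s x) :
    ∀ z : ℂ, 0 < z.re → ∃ C r : ℝ, 0 ≤ C ∧ 0 < r ∧
      ∀ μ : skewMatrices ((IsCMField.complexConj L : L ≃ₐ[Fp L] L) : L →+* L) ((gramR L e₁ d₁ hd₁ w₁ hw₁).map (algebraMap (Fp L) L)),
        (μ : Matrix (Fin 1) (Fin 1) L).det ≠ 0 → ∀ s : ℂ, dist s z < r → ∀ x : X,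
          ‖whittakerDelta L e₁ d₁ hd₁ w₁ hw₁ ν₁ (μ : Matrix (Fin 1) (Fin 1) L) (Φ x s) 1‖ ≤ C * B μ s x := by
  intro z hz
  obtain ⟨C, r, hC, hr, hb⟩ := hfine z hz
  have hσ₀ : 0 < z.re / 2 := by linarith
  obtain ⟨CL, hCL, hT⟩ := exists_norm_whittakerDelta_le_of_linePart_le L e₁ d₁ hd₁ w₁ hw₁ ν₁ Φ A₁ U₁ hEuler₁ hσ₀
  refine ⟨CL * C, min r (z.re / 2), mul_nonneg hCL.le hC, lt_min hr hσ₀, fun μ hμ s hs x => ?_⟩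
  exact hT μ hμ s x (half_re_le_re_of_dist_lt hs) (hb μ s (lt_of_lt_of_le hs (min_le_left _ _)) x)

/-- **THE TOP SHAPE TRANSFERRED**: the height-form Gaussian decay bytes `hdec₁` (★ (KW1-d) §3, ★ `kindOne_weight_of_decay`) for `A₁` ⇒ the same bytes for the Whittaker
coefficient on `det μ ≠ 0` (radius `min r (re z ∕ 2)`, constant `C_L(re z ∕ 2) · C`, exponents unchanged). [cite: KudlaRallis1994, §1] [cite: Tan1999, §2–§3] -/
theorem exists_whittakerDelta_dec_of_dec
    [MeasurableSpace (unipDelta L e₁ d₁ hd₁ w₁ hw₁)] (ν₁ : Measure (unipDelta L e₁ d₁ hd₁ w₁ hw₁))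
    {X : Type*} {N : ℕ} (ht : X → GL (Fin N) (AdeleRing (𝓞 L) L)) (Φ : X → ℂ → HA L e₁ d₁ hd₁ w₁ hw₁ → ℂ)
    (A₁ : skewMatrices ((IsCMField.complexConj L : L ≃ₐ[Fp L] L) : L →+* L) ((gramR L e₁ d₁ hd₁ w₁ hw₁).map (algebraMap (Fp L) L)) → ℂ → X → ℂ)
    (U₁ : skewMatrices ((IsCMField.complexConj L : L ≃ₐ[Fp L] L) : L →+* L) ((gramR L e₁ d₁ hd₁ w₁ hw₁).map (algebraMap (Fp L) L)) → X →
      Set (HeightOneSpectrum (𝓞 ↥(maximalRealSubfield L))))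
    (hEuler₁ : ∀ μ : skewMatrices ((IsCMField.complexConj L : L ≃ₐ[Fp L] L) : L →+* L) ((gramR L e₁ d₁ hd₁ w₁ hw₁).map (algebraMap (Fp L) L)),
      (μ : Matrix (Fin 1) (Fin 1) L).det ≠ 0 → ∀ (s : ℂ) (x : X), 0 < s.re →
        whittakerDelta L e₁ d₁ hd₁ w₁ hw₁ ν₁ (μ : Matrix (Fin 1) (Fin 1) L) (Φ x s) 1 =
          A₁ μ s x * (partialStandardL (U₁ μ x) (fun v => {(quadraticHeckeCharCM L).valueAtUniformizer v}) (2 * (s + 1 / 2) + 1))⁻¹)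
    (τ₁ : skewMatrices ((IsCMField.complexConj L : L ≃ₐ[Fp L] L) : L →+* L) ((gramR L e₁ d₁ hd₁ w₁ hw₁).map (algebraMap (Fp L) L)) → ℝ) (NW₁ : ℕ)
    (hdec₁ : ∀ z : ℂ, 0 < z.re → ∃ C a c a' r : ℝ, 0 ≤ C ∧ 0 ≤ a ∧ 0 < c ∧ 0 ≤ a' ∧ 0 < r ∧ ∀ μ (s : ℂ), dist s z < r → ∀ x : X,
      ‖A₁ μ s x‖ ≤ C * adelicHeightGL N L (ht x) ^ a * (Real.exp (-(c * adelicHeightGL N L (ht x) ^ (-a') * τ₁ μ)) * (1 + τ₁ μ) ^ NW₁)) :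
    ∀ z : ℂ, 0 < z.re → ∃ C a c a' r : ℝ, 0 ≤ C ∧ 0 ≤ a ∧ 0 < c ∧ 0 ≤ a' ∧ 0 < r ∧
      ∀ μ : skewMatrices ((IsCMField.complexConj L : L ≃ₐ[Fp L] L) : L →+* L) ((gramR L e₁ d₁ hd₁ w₁ hw₁).map (algebraMap (Fp L) L)),
        (μ : Matrix (Fin 1) (Fin 1) L).det ≠ 0 → ∀ s : ℂ, dist s z < r → ∀ x : X,
          ‖whittakerDelta L e₁ d₁ hd₁ w₁ hw₁ ν₁ (μ : Matrix (Fin 1) (Fin 1) L) (Φ x s) 1‖ ≤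
            C * adelicHeightGL N L (ht x) ^ a * (Real.exp (-(c * adelicHeightGL N L (ht x) ^ (-a') * τ₁ μ)) * (1 + τ₁ μ) ^ NW₁) := by
  intro z hz
  obtain ⟨C, a, c, a', r, hC, ha, hc, ha', hr, hb⟩ := hdec₁ z hz
  have hσ₀ : 0 < z.re / 2 := by linarith
  obtain ⟨CL, hCL, hT⟩ := exists_norm_whittakerDelta_le_of_linePart_le L e₁ d₁ hd₁ w₁ hw₁ ν₁ Φ A₁ U₁ hEuler₁ hσ₀
  refine ⟨CL * C, a, c, a', min r (z.re / 2), mul_nonneg hCL.le hC, ha, hc, ha', lt_min hr hσ₀, fun μ hμ s hs x => ?_⟩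
  have h := hT μ hμ s x (half_re_le_re_of_dist_lt hs) (C₁ := C * adelicHeightGL N L (ht x) ^ a)
    (G := Real.exp (-(c * adelicHeightGL N L (ht x) ^ (-a') * τ₁ μ)) * (1 + τ₁ μ) ^ NW₁)
    (hb μ s (lt_of_lt_of_le hs (min_le_left _ _)) x)
  calc ‖whittakerDelta L e₁ d₁ hd₁ w₁ hw₁ ν₁ (μ : Matrix (Fin 1) (Fin 1) L) (Φ x s) 1‖
      ≤ CL * (C * adelicHeightGL N L (ht x) ^ a) * (Real.exp (-(c * adelicHeightGL N L (ht x) ^ (-a') * τ₁ μ)) * (1 + τ₁ μ) ^ NW₁) := h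
    _ = CL * C * adelicHeightGL N L (ht x) ^ a * (Real.exp (-(c * adelicHeightGL N L (ht x) ^ (-a') * τ₁ μ)) * (1 + τ₁ μ) ^ NW₁) := by ring

end Transfer

end Summit.HodgeConjecture.HodgeConjecture.Cruxes.HLiu418.K2LiuKindOneLineEulerTransfer

end
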